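import Summits.ValiantsHypothesis.ValiantsHypothesis.Theorems.LacunarySymmetroidMatrixDescartesJunctionCeilingSeam

/-!
# `MatrixDescartes` — the JUNCTION CEILING, Theorems-side port 3/3: «+1» is dead EVEN WITH NONSINGULAR FAR ENDS (`¬ SeamCeiling 2 1`),
# and the far-end hypothesis is needed (the LEAK example)

HONEST FRAMING (port).  Theorems of the crux workfile `Cruxes/MatrixDescartes/Lines/junction_ceiling.lean` (val-idea-5 g2 deliverable
(B), sha16 ec3c5bea67a7dcd8, 0 sorries) ported VERBATIM over `…JunctionCeilingSeamDefs` / `…JunctionCeilingSeam` (porter val-port-4 g1,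
val-lit desk g11 RULING #233 (b)): §4b = witness `SeamTwoNonsingular` (same corank-one junction letter `diag(1,0)` and middle letters as
§4, far ends `diag(1/8,1)` / `diag(1/8,−1)` NONSINGULAR; `det H_Λ` alternates `+,−,+,−` at `½, 2, t, 2t`, THREE roots = 1 + 0 + 2) and
**`not_seamCeiling_two_one : ¬ SeamCeiling 2 1`**; §5 = witness `Leak` (nonsingular junction letter `diag(1,−1)`, RANK-ONE bottom letter
`[[1,1],[1,1]]`: `det P = −X⁶`, `det Q = X − 1`, `det H_Λ = −X⁶ + Λ⁻¹X⁴ + Λ⁻¹X⁷` has TWO positive roots) and **`zeroLeak_example`**: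
the far-end nonsingularity hypothesis of `KernelDefiniteJunction` / `NonsingularJunctionAdditive` cannot be dropped.  Witness data are
small `def`s (review-queued with the file; D-0009).  `SeamCeiling 2 2` («a seam carries at most m roots») stays an OPEN guess of the
workfile — not stubbed, not asserted.  Nothing here is a law or bears on `MatrixDescartes` (stmt-ValiantsHypothesis-18050), `DoorA26`,
Conjecture B or VP ≠ VNP.  [folklore]
-/

-- `Summit.ValiantsHypothesis.ValiantsHypothesis.…` repeats a component by the D-0017 layout
-- (single-conjunct summit), which the `dupNamespace` linter flags; the name is mandated.
set_option linter.dupNamespace false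
set_option autoImplicit false

namespace Summit.ValiantsHypothesis.ValiantsHypothesis.Theorems.LacunarySymmetroidMatrixDescartes.JunctionCeiling

open Polynomial Finset Filter
open scoped BigOperators
open Summit.ValiantsHypothesis.ValiantsHypothesis.Theorems.SymmetroidDescartes (eval_det_pencil le_card_posRoots_of_alternating)

/-! ## 4b. «+1» is dead EVEN WITH NONSINGULAR FAR ENDS: `¬ SeamCeiling 2 1` (kernel, sorry-free)

Same corank-one junction letter `J = diag(1,0)` and the same two middle letters; far ends made nonsingular: bottom of `P` = `diag(1/8, 1)`
(definite), top of `Q` = `diag(1/8, −1)` (indefinite) placed at exponent `5` so that the `P`-side dominates `H₂₂` on the seam.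
`det P = 1/8 + X⁴ − X⁶` (one variation ⇒ `ζ• ≤ 1`), `det Q = −X² − X⁵ − X¹⁰/8` (no positive root), and
`det H_Λ = 1/8 + X⁴ − X⁶ + 2Λ⁻¹X⁸ − Λ⁻²X¹⁰ − Λ⁻⁵X¹³ − Λ⁻¹⁰X¹⁸/8` alternates `+,−,+,−` at `½, 2, √Λ, 2√Λ` (`Λ ≥ 16`): THREE roots = 1 + 0 + 2.
(Exact Sturm cross-check `seam/nonsing_ends2.py`: ζ(H) = 3, all simple, for t = 4 … 10⁴.) -/

namespace SeamTwoNonsingular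

/-- Exponent data of the witness. -/
def dP : Fin 3 → ℕ := ![0, 3, 4]
/-- Letter data of the witness (symmetric `2 × 2`). -/
noncomputable def SP : Fin 3 → Matrix (Fin 2) (Fin 2) ℝ := ![!![1/8, 0; 0, 1], !![0, 1; 1, 0], !![1, 0; 0, 0]]
/-- Exponent data of the witness. -/
def eQ : Fin 3 → ℕ := ![0, 1, 5]
/-- Letter data of the witness (symmetric `2 × 2`). -/
noncomputable def TQ : Fin 3 → Matrix (Fin 2) (Fin 2) ℝ := ![!![1, 0; 0, 0], !![0, -1; -1, 0], !![1/8, 0; 0, -1]]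

/-- The exponents are strictly increasing. -/
theorem dP_strictMono : StrictMono dP := by
  refine Fin.strictMono_iff_lt_succ.2 fun j => ?_
  fin_cases j <;> simp [dP]

/-- The exponents are strictly increasing. -/
theorem eQ_strictMono : StrictMono eQ := by
  refine Fin.strictMono_iff_lt_succ.2 fun j => ?_
  fin_cases j <;> simp [eQ]

/-- The letters are symmetric. -/
theorem SP_symm (l : Fin 3) : (SP l).IsSymm := by
  fin_cases l <;> (unfold Matrix.IsSymm; ext i j; fin_cases i <;> fin_cases j <;> rfl)

/-- The letters are symmetric. -/
theorem TQ_symm (l : Fin 3) : (TQ l).IsSymm := by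
  fin_cases l <;> (unfold Matrix.IsSymm; ext i j; fin_cases i <;> fin_cases j <;> rfl)

/-- Junction condition: the bottom letter of `Q` is the top letter of `P`. -/
theorem TQ_zero : TQ 0 = SP (Fin.last 2) := by
  ext i j; fin_cases i <;> fin_cases j <;> rfl

/-- The bottom far-end letter of `P` is nonsingular. -/
theorem S0_det : (SP 0).det ≠ 0 := by
  simp [SP, Matrix.det_fin_two]

/-- The top far-end letter of `Q` is nonsingular. -/
theorem Tlast_det : (TQ (Fin.last 2)).det ≠ 0 := by
  simp [TQ, Matrix.det_fin_two, Fin.last]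

/-- Closed form of the block determinant. -/
theorem detP_eq : (pencil dP SP).det = C (1/8) + X ^ 4 - X ^ 6 := by
  apply Polynomial.funext
  intro t
  unfold pencil
  rw [eval_det_pencil]
  simp [Matrix.det_fin_two, Fin.sum_univ_three, dP, SP]
  ring

/-- Closed form of `det Q` evaluated at a point. -/
theorem eval_detQ (y : ℝ) : ((pencil eQ TQ).det).eval y = -y ^ 2 - y ^ 5 - 1/8 * y ^ 10 := by
  unfold pencil
  rw [eval_det_pencil]
  simp [Matrix.det_fin_two, Fin.sum_univ_three, eQ, TQ]
  ring

/-- The block determinant is not the zero polynomial. -/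
theorem detP_ne_zero : (pencil dP SP).det ≠ 0 := by
  rw [detP_eq]
  intro h
  have h4 := congrArg (fun p : ℝ[X] => p.coeff 4) h
  simp [coeff_X_pow] at h4

/-- The block determinant is not the zero polynomial. -/
theorem detQ_ne_zero : (pencil eQ TQ).det ≠ 0 := by
  intro h
  have h1 := eval_detQ 1
  rw [h] at h1
  norm_num at h1

/-- Descartes: `1/8 + X⁴ − X⁶` has one sign variation, hence at most one positive root with multiplicity. -/
theorem posM_P : posM (pencil dP SP).det ≤ 1 := by
  unfold posM
  refine (roots_countP_pos_le_signVariations _).trans ?_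
  rw [detP_eq]
  refine Summit.ValiantsHypothesis.ValiantsHypothesis.Theorems.LacunarySymmetroidMatrixDescartes.StubCommutingTwoSided.signVariations_le_one_of_natDegree_le
    _ 6 (fun n hn => ?_) (by compute_degree!)
  simp only [coeff_add, coeff_sub, coeff_C, coeff_X_pow, if_neg hn]
  split_ifs <;> norm_num

/-- `det Q < 0` on `(0, ∞)`: no positive root at all. -/
theorem posM_Q : posM (pencil eQ TQ).det = 0 := by
  unfold posM
  rw [Multiset.countP_eq_zero]
  intro y hy hpos
  have hr := (mem_roots detQ_ne_zero).1 hy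
  rw [IsRoot.def, eval_detQ] at hr
  nlinarith [pow_pos hpos 2, pow_pos hpos 5, pow_pos hpos 10]

/-- Closed form of `det H_Λ` (the junction pencil at scale `Λ`) evaluated at `x`. -/
theorem eval_detH (Λ x : ℝ) :
    ((junction 2 2 dP SP eQ TQ Λ).det).eval x =
      1/8 + x ^ 4 - x ^ 6 + 2 * Λ⁻¹ * x ^ 8 - Λ⁻¹ ^ 2 * x ^ 10 - Λ⁻¹ ^ 5 * x ^ 13 - 1/8 * Λ⁻¹ ^ 10 * x ^ 18 := by
  unfold junction pencil
  rw [eval_det_pencil]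
  simp [Matrix.det_fin_two, Fintype.sum_sum_type, Fin.sum_univ_three, Fin.sum_univ_two, dP, SP, eQ, TQ]
  ring

/-- Sign of `det H_Λ` at a certificate point (`Λ = t²`). -/
theorem val_half (t : ℝ) (ht : 4 ≤ t) : 0 < ((junction 2 2 dP SP eQ TQ (t ^ 2)).det).eval (1 / 2) := by
  rw [eval_detH]
  have hu0 : 0 ≤ (t ^ 2)⁻¹ := by positivity
  have hu1 : (t ^ 2)⁻¹ ≤ 1 := inv_le_one_of_one_le₀ (by nlinarith)
  have a2 : ((t ^ 2)⁻¹) ^ 2 ≤ 1 := pow_le_one₀ hu0 hu1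
  have a5 : ((t ^ 2)⁻¹) ^ 5 ≤ 1 := pow_le_one₀ hu0 hu1
  have a10 : ((t ^ 2)⁻¹) ^ 10 ≤ 1 := pow_le_one₀ hu0 hu1
  nlinarith

/-- Sign of `det H_Λ` at a certificate point (`Λ = t²`). -/
theorem val_two (t : ℝ) (ht : 4 ≤ t) : ((junction 2 2 dP SP eQ TQ (t ^ 2)).det).eval 2 < 0 := by
  rw [eval_detH]
  have hu0 : 0 ≤ (t ^ 2)⁻¹ := by positivity
  have hi : (t ^ 2)⁻¹ ≤ 1 / 16 := by
    rw [inv_le_comm₀ (by positivity) (by norm_num)]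
    nlinarith
  have a2 : 0 ≤ ((t ^ 2)⁻¹) ^ 2 := by positivity
  have a5 : 0 ≤ ((t ^ 2)⁻¹) ^ 5 := by positivity
  have a10 : 0 ≤ ((t ^ 2)⁻¹) ^ 10 := by positivity
  nlinarith

/-- Sign of `det H_Λ` at a certificate point (`Λ = t²`). -/
theorem val_t (t : ℝ) (ht : 4 ≤ t) : 0 < ((junction 2 2 dP SP eQ TQ (t ^ 2)).det).eval t := by
  rw [eval_detH]
  have ht0 : t ≠ 0 := by positivity
  have h : 1/8 + t ^ 4 - t ^ 6 + 2 * (t ^ 2)⁻¹ * t ^ 8 - (t ^ 2)⁻¹ ^ 2 * t ^ 10 - (t ^ 2)⁻¹ ^ 5 * t ^ 13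
      - 1/8 * (t ^ 2)⁻¹ ^ 10 * t ^ 18 = (8 * t ^ 6 - 8 * t ^ 5 + t ^ 2 - 1) / (8 * t ^ 2) := by
    field_simp
    ring
  rw [h]
  have hn : 0 < 8 * t ^ 6 - 8 * t ^ 5 + t ^ 2 - 1 := by
    have h5 : 0 < t ^ 5 := by positivity
    nlinarith
  positivity

/-- Sign of `det H_Λ` at a certificate point (`Λ = t²`). -/
theorem val_2t (t : ℝ) (ht : 4 ≤ t) : ((junction 2 2 dP SP eQ TQ (t ^ 2)).det).eval (2 * t) < 0 := by
  rw [eval_detH]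
  have ht0 : t ≠ 0 := by positivity
  have h : 1/8 + (2 * t) ^ 4 - (2 * t) ^ 6 + 2 * (t ^ 2)⁻¹ * (2 * t) ^ 8 - (t ^ 2)⁻¹ ^ 2 * (2 * t) ^ 10
      - (t ^ 2)⁻¹ ^ 5 * (2 * t) ^ 13 - 1/8 * (t ^ 2)⁻¹ ^ 10 * (2 * t) ^ 18
      = -((576 * t ^ 8 - 16 * t ^ 6 + 8192 * t ^ 5 - 1/8 * t ^ 2 + 32768) / t ^ 2) := by
    field_simp
    ring
  rw [h, neg_lt_zero]
  have hn : 0 < 576 * t ^ 8 - 16 * t ^ 6 + 8192 * t ^ 5 - 1/8 * t ^ 2 + 32768 := by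
    have h6 : 0 < t ^ 6 := by positivity
    have h5 : 0 < t ^ 5 := by positivity
    have h16 : 16 ≤ t ^ 2 := by nlinarith
    have h8 : 16 * t ^ 6 ≤ t ^ 8 := by nlinarith [mul_le_mul_of_nonneg_left h16 h6.le]
    have h25 : t ^ 2 ≤ t ^ 5 := pow_le_pow_right₀ (by linarith) (by norm_num)
    linarith
  positivity

/-- Sign alternation at the certificate points ⇒ that many distinct positive roots of `det H_Λ` (`Λ = t²`). -/
theorem three_le_posD (t : ℝ) (ht : 4 ≤ t) : 3 ≤ posD (junction 2 2 dP SP eQ TQ (t ^ 2)).det := by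
  unfold posD
  refine le_card_posRoots_of_alternating _ 3 (![1 / 2, 2, t, 2 * t] : Fin 4 → ℝ) ?_ ?_ ?_
  · refine Fin.strictMono_iff_lt_succ.2 fun j => ?_
    fin_cases j <;> simp <;> nlinarith
  · intro j
    fin_cases j <;> simp <;> positivity
  · intro j
    fin_cases j <;> simp only
    · exact mul_neg_of_pos_of_neg (val_half t ht) (val_two t ht)
    · exact mul_neg_of_neg_of_pos (val_two t ht) (val_t t ht)
    · exact mul_neg_of_pos_of_neg (val_t t ht) (val_2t t ht)

end SeamTwoNonsingular

/-- **`SeamCeiling 2 1` is false**: with nonsingular far ends a corank-one junction still carries TWO extra roots. -/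
theorem not_seamCeiling_two_one : ¬ SeamCeiling 2 1 := by
  intro h
  have hev := h 2 2 SeamTwoNonsingular.dP SeamTwoNonsingular.SP SeamTwoNonsingular.eQ SeamTwoNonsingular.TQ
    SeamTwoNonsingular.dP_strictMono SeamTwoNonsingular.eQ_strictMono SeamTwoNonsingular.SP_symm SeamTwoNonsingular.TQ_symm
    SeamTwoNonsingular.TQ_zero SeamTwoNonsingular.S0_det SeamTwoNonsingular.Tlast_det
    SeamTwoNonsingular.detP_ne_zero SeamTwoNonsingular.detQ_ne_zero
  obtain ⟨Λ₀, hΛ₀⟩ := Filter.eventually_atTop.1 hev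
  set t : ℝ := max Λ₀ 4 with ht_def
  have ht4 : 4 ≤ t := le_max_right _ _
  have htΛ : Λ₀ ≤ t ^ 2 := by
    have : Λ₀ ≤ t := le_max_left _ _
    nlinarith
  have hle := hΛ₀ (t ^ 2) htΛ
  have h3 := SeamTwoNonsingular.three_le_posD t ht4
  have hP := SeamTwoNonsingular.posM_P
  have hQ := SeamTwoNonsingular.posM_Q
  omega

/-! ## 5. The far-end hypothesis is needed: a root LEAKS out of `x = 0` through a rank-one bottom letter (nonsingular junction letter) -/

namespace Leak

/-- Exponent data of the witness. -/
def dP : Fin 2 → ℕ := ![0, 3]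
/-- bottom letter `[[1,1],[1,1]]` (rank one), junction letter `J = diag(1,−1)` (nonsingular). -/
def SP : Fin 2 → Matrix (Fin 2) (Fin 2) ℝ := ![!![1, 1; 1, 1], !![1, 0; 0, -1]]
/-- Exponent data of the witness. -/
def eQ : Fin 2 → ℕ := ![0, 1]
/-- Letter data of the witness (symmetric `2 × 2`). -/
def TQ : Fin 2 → Matrix (Fin 2) (Fin 2) ℝ := ![!![1, 0; 0, -1], !![0, 0; 0, 1]]

/-- Closed form of the block determinant. -/
theorem detP_eq : (pencil dP SP).det = C 0 * X ^ 0 + C (-1) * X ^ 6 := by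
  apply Polynomial.funext
  intro t
  unfold pencil
  rw [eval_det_pencil]
  simp [Matrix.det_fin_two, Fin.sum_univ_two, dP, SP]
  ring

/-- Closed form of the block determinant. -/
theorem detQ_eq : (pencil eQ TQ).det = C (-1) * X ^ 0 + C 1 * X ^ 1 := by
  apply Polynomial.funext
  intro t
  unfold pencil
  rw [eval_det_pencil]
  simp [Matrix.det_fin_two, Fin.sum_univ_two, eQ, TQ]

/-- `det P = −X⁶` has NO positive root. -/
theorem posM_P : posM (pencil dP SP).det = 0 := by
  unfold posM
  rw [detP_eq]
  have h : (C (0:ℝ) * X ^ 0 + C (-1) * X ^ 6 : ℝ[X]) = C (-1) * X ^ 6 := by simp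
  rw [h, Polynomial.roots_C_mul _ (by norm_num), Polynomial.roots_X_pow]
  simp [Multiset.countP_eq_zero]

/-- Positive roots of the block determinant, counted with multiplicity. -/
theorem posM_Q : posM (pencil eQ TQ).det ≤ 1 :=
  posM_le_one_of_binomial 0 1 (-1) 1 detQ_eq (by
    rw [detQ_eq]; intro h
    have h1 := congrArg (fun p : ℝ[X] => p.coeff 1) h
    simp [Polynomial.coeff_one] at h1)

/-- Closed form of `det H_Λ` (the junction pencil at scale `Λ`) evaluated at `x`. -/
theorem eval_detH (Λ x : ℝ) :
    ((junction 1 1 dP SP eQ TQ Λ).det).eval x = -x ^ 6 + Λ⁻¹ * x ^ 4 + Λ⁻¹ * x ^ 7 := by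
  unfold junction pencil
  rw [eval_det_pencil]
  simp [Matrix.det_fin_two, Fintype.sum_sum_type, Fin.sum_univ_two, dP, SP, eQ, TQ]
  ring

/-- two positive roots for every `Λ = t²`, `t ≥ 2`: signs `+,−,+` at `1/t, 1, 2t²` (the leaked root sits just above `1/t → 0`: `det H_{t²}(1/t) = t⁻⁹`). -/
theorem two_le_posD (t : ℝ) (ht : 2 ≤ t) : 2 ≤ posD (junction 1 1 dP SP eQ TQ (t ^ 2)).det := by
  unfold posD
  have ht0 : t ≠ 0 := by positivity
  have v1 : 0 < ((junction 1 1 dP SP eQ TQ (t ^ 2)).det).eval (1 / t) := by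
    rw [eval_detH]
    have h : -(1 / t) ^ 6 + (t ^ 2)⁻¹ * (1 / t) ^ 4 + (t ^ 2)⁻¹ * (1 / t) ^ 7 = 1 / t ^ 9 := by
      field_simp; ring
    rw [h]
    positivity
  have v2 : ((junction 1 1 dP SP eQ TQ (t ^ 2)).det).eval 1 < 0 := by
    rw [eval_detH]
    have hi : (t ^ 2)⁻¹ ≤ 1 / 4 := by
      rw [inv_le_comm₀ (by positivity) (by norm_num)]; nlinarith
    nlinarith
  have v3 : 0 < ((junction 1 1 dP SP eQ TQ (t ^ 2)).det).eval (2 * t ^ 2) := by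
    rw [eval_detH]
    have h : -(2 * t ^ 2) ^ 6 + (t ^ 2)⁻¹ * (2 * t ^ 2) ^ 4 + (t ^ 2)⁻¹ * (2 * t ^ 2) ^ 7
        = t ^ 6 * (16 + 64 * t ^ 6) := by
      field_simp; ring
    rw [h]; positivity
  refine le_card_posRoots_of_alternating _ 2 (![1 / t, 1, 2 * t ^ 2] : Fin 3 → ℝ) ?_ ?_ ?_
  · refine Fin.strictMono_iff_lt_succ.2 fun j => ?_
    fin_cases j <;> simp
    · exact inv_lt_one_of_one_lt₀ (by linarith)
    · nlinarith
  · intro j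
    fin_cases j <;> simp <;> positivity
  · intro j
    fin_cases j <;> simp only
    · exact mul_neg_of_pos_of_neg v1 v2
    · exact mul_neg_of_neg_of_pos v2 v3

/-- **LEAK**: nonsingular junction letter, rank-one far end: eventually-always `ζ(H_Λ) ≥ ζ•(P) + ζ•(Q) + 1`. -/
theorem zeroLeak_example (t : ℝ) (ht : 2 ≤ t) :
    posM (pencil dP SP).det + posM (pencil eQ TQ).det + 1 ≤ posD (junction 1 1 dP SP eQ TQ (t ^ 2)).det := by
  have := two_le_posD t ht
  have hP := posM_P
  have hQ := posM_Q
  omega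

end Leak

end Summit.ValiantsHypothesis.ValiantsHypothesis.Theorems.LacunarySymmetroidMatrixDescartes.JunctionCeiling
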